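/-
Copyright (c) 2026 the pub-hodgecm-mathlib formalisation cell (harness21).  Prover seat hodgecm-mathlib-LH4-p06 (g4), Track A «(D-RAM) FOUR-FRAME», unit U2H, the census leaf
(ρ2b′-X) `stub_U2H_fixedPointCensus_typeTwo_unit0` — payer LH4-p14 (g3) requirement (R1) «depth-refined level sets» (03:55:54Z); this seat's T5c sheet v3 sentence (D0);
type-free organ shared by T5a∕T5b∕T5c∕O-Sum.  2026-09-04.
-/
import Literature.NumberTheory.LocalFields.QuadraticOrderHermitianDual   -- ★ p857067 T4c (`forall_dual_mul_mem_iff`: depth `μ·Λ^# ⊆ Λ ⟺ μ∕y` in the order) → ★ p857040 → ★ p857021 (orders of conductor `c`)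
import HarnessLib

/-!
# Order SCALING for the depth condition: a scaled unit `ϖE^k·z` lies in the order of conductor `ϖE^j` iff `j ≤ k` or `z` lies in the order of conductor `ϖE^{j−k}`;
# hence the census's DEPTH CONDITION `μ∕y ∈ 𝒪_j` is «`a ≤ m` and `μ∕(y·ϖE^{m−a}) ∈ 𝒪_{j−(m−a)}`» (Serre, *Local Fields* Ch. III §6 Prop. 12; Jacobowitz 1962 §4)

Topic `NumberTheory/LocalFields`; namespace `Literature.NumberTheory.LocalFields.QuadraticOrder` (= ★ T4 parts I–III p857021 ∕ p857040 ∕ p857067).  THEOREMS ONLY (no definition,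
no instance, no notation, no named fact, no `sorry`); kernel lane `--supports stmt-HodgeConjecture-24833` (count-neutral).  Cell `pub/hodgecm-mathlib` (D-0151), crux H413, Track A
«(D-RAM) FOUR-FRAME», unit U2H: in the toric ∕ order reduction of the WILD type-(2) fixed-point census (ρ2b′-X) (LH4-p12 PAYER-PLAN-rho2bX v2 D4; LH4-p14 (g3) O-Sum; F0P3a-p01 (g32)
E1 v0 §3 (b) «`DEP ⟺ a ≤ m ∧ (m − a ≥ j ∨ depth(z_ω) ≥ j − m + a)`, `z_ω := (λ−u)∕(y_ω ϖ^{m−a})`») a lattice `Λ = x₀·𝒪_j` with dual generator `y` (`|y| = |ϖE|^a`) passes the DEPTH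
test `(λ − u)·Λ^# ⊆ Λ` iff `μ∕y ∈ 𝒪_j`, `μ := λ − u` (★ T4c `forall_dual_mul_mem_iff`), and `|μ| = |ϖE|^m` is the census depth token.  THIS FILE turns «`μ∕y ∈ 𝒪_j`» into the
FIBRE CONDITION the level census counts — `a ≤ m` and the UNIT `z := μ∕(y·ϖE^{m−a})` lies in the SMALLER order `𝒪_{j−(m−a)}` (no condition when `j ≤ m − a`):
* §1 `order_pow_mul_iff` — for a `ρ`-fixed integer `ϖE ≠ 0` and an integer `z` with `|z − ρz| ≤ |α − ρα|` (every integer, ★ `v_sub_map_le_of_v_le_one`):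
  `ϖE^k·z ∈ 𝒪_{ϖE^j} ⟺ j ≤ k ∨ z ∈ 𝒪_{ϖE^{j−k}}` (orders spelled as ★ T4's predicate `|w| ≤ 1 ∧ |w − ρw| ≤ |c(α − ρα)|`).
* §2 `div_mem_order_iff_of_v_eq` — for `|y| = |ϖE|^a`, `|μ| = |ϖE|^m`, `y, ϖE ≠ 0`, `|ϖE| < 1`: `μ∕y ∈ 𝒪_{ϖE^j} ⟺ a ≤ m ∧ (j ≤ m − a ∨ μ∕(y·ϖE^{m−a}) ∈ 𝒪_{ϖE^{j−(m−a)}})`.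
* §2 `forall_dual_mul_mem_iff_depthUnit` — the same read on the lattice `Λ = x₀·𝒪_j` with the hermitian dual of ★ T4c (`y = h·(x₀Θx₀)·(ϖE^j(α − ρα))`): the sentence (D0) of the
  T5 sheets (`levelSetDep`), type-free (any `|ϖE| < 1`: `exp(−1)` in the M∕E-unramified frame, `exp(−2)` in the ramified one).
HONEST LABEL: HC_CM is proved only modulo the 7 printed citations (2 remaining named inputs: hLiu418 = stmt-HodgeConjecture-24832, h413 = stmt-HodgeConjecture-24833) until rung 0
closes; unconditional local algebra, count-neutral (organ (D0) of the T5 census; the depth RULE itself — which classes pass — is the open census content).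

## References
* [Serre1979] J.-P. Serre, *Local Fields*, GTM 67 (1979): Ch. III §6 Prop. 12 (orders `𝒪_E + c𝒪_M` of a quadratic extension), Ch. V §3.
* [Jacobowitz1962] R. Jacobowitz, *Hermitian forms over local fields*, Amer. J. Math. 84 (1962): §4 (duals and modular hermitian lattices).
-/

set_option autoImplicit false

open WithZero

namespace Literature.NumberTheory.LocalFields.QuadraticOrder

variable {K : Type*} [Field K] [Valued K ℤᵐ⁰] {ρ Θ : K →+* K} {α : K}

/-! ## §1 Scaling a unit of the big ring into and out of an order -/

/-- **ORDER SCALING.**  For a `ρ`-fixed integer `ϖE ≠ 0`, an integer `z` with `|z − ρz| ≤ |α − ρα|` and exponents `j k`: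
`ϖE^k·z` lies in the order of conductor `ϖE^j` **iff `j ≤ k` or `z` lies in the order of conductor `ϖE^{j−k}`** (`|ϖE^k z − ρ(ϖE^k z)| = |ϖE|^k·|z − ρz|`; cancel `|ϖE|^k`).
[cite: Serre1979, Ch. III §6 Prop. 12] -/
theorem order_pow_mul_iff {ϖE : K} (hρϖ : ρ ϖE = ϖE) (hϖ0 : ϖE ≠ 0) (hϖ1 : Valued.v ϖE ≤ 1) {z : K} (hz : Valued.v z ≤ 1)
    (hzδ : Valued.v (z - ρ z) ≤ Valued.v (α - ρ α)) (j k : ℕ) :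
    (Valued.v (ϖE ^ k * z) ≤ 1 ∧ Valued.v (ϖE ^ k * z - ρ (ϖE ^ k * z)) ≤ Valued.v (ϖE ^ j * (α - ρ α))) ↔
      (j ≤ k ∨ (Valued.v z ≤ 1 ∧ Valued.v (z - ρ z) ≤ Valued.v (ϖE ^ (j - k) * (α - ρ α)))) := by
  have hvϖ0 : Valued.v ϖE ≠ 0 := (Valuation.ne_zero_iff _).2 hϖ0
  have hvpos : ∀ n : ℕ, 0 < Valued.v ϖE ^ n := fun n => pow_pos (zero_lt_iff.2 hvϖ0) n
  have hint1 : Valued.v (ϖE ^ k * z) ≤ 1 := by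
    rw [map_mul, map_pow]; exact mul_le_one' (pow_le_one₀ zero_le hϖ1) hz
  have htw : Valued.v (ϖE ^ k * z - ρ (ϖE ^ k * z)) = Valued.v ϖE ^ k * Valued.v (z - ρ z) := by
    rw [map_mul ρ, map_pow ρ, hρϖ, ← mul_sub, map_mul, map_pow]
  have hcv : ∀ n : ℕ, Valued.v (ϖE ^ n * (α - ρ α)) = Valued.v ϖE ^ n * Valued.v (α - ρ α) := fun n => by
    rw [map_mul, map_pow]
  rw [htw, hcv, hcv]
  constructor
  · rintro ⟨-, h⟩
    by_cases hjk : j ≤ k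
    · exact Or.inl hjk
    · refine Or.inr ⟨hz, ?_⟩
      have h' : Valued.v ϖE ^ k * Valued.v (z - ρ z) ≤ Valued.v ϖE ^ k * (Valued.v ϖE ^ (j - k) * Valued.v (α - ρ α)) := by
        rwa [← mul_assoc, ← pow_add, show k + (j - k) = j by omega]
      exact le_of_mul_le_mul_left h' (hvpos k)
  · rintro (hjk | ⟨-, h⟩)
    · exact ⟨hint1, (mul_le_mul_right hzδ _).trans (mul_le_mul_left (pow_le_pow_right_of_le_one' hϖ1 hjk) _)⟩
    · refine ⟨hint1, ?_⟩
      by_cases hjk : j ≤ k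
      · rw [show j - k = 0 by omega, pow_zero, one_mul] at h
        exact (mul_le_mul_right h _).trans (mul_le_mul_left (pow_le_pow_right_of_le_one' hϖ1 hjk) _)
      · calc Valued.v ϖE ^ k * Valued.v (z - ρ z) ≤ Valued.v ϖE ^ k * (Valued.v ϖE ^ (j - k) * Valued.v (α - ρ α)) :=
              mul_le_mul_right h _
          _ = Valued.v ϖE ^ j * Valued.v (α - ρ α) := by rw [← mul_assoc, ← pow_add, show k + (j - k) = j by omega]

/-! ## §2 The depth condition `μ∕y ∈ 𝒪_j` as a fibre condition on the unit `μ∕(y·ϖE^{m−a})` -/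

/-- **THE DEPTH CONDITION, UNIT FORM.**  `|y| = |ϖE|^a`, `|μ| = |ϖE|^m` (`y, ϖE ≠ 0`, `0 < |ϖE| < 1`, `ϖE` `ρ`-fixed, `hint` for the integral basis): `μ∕y` lies in the order of
conductor `ϖE^j` **iff `a ≤ m` and (`j ≤ m − a` or the UNIT `μ∕(y·ϖE^{m−a})` lies in the order of conductor `ϖE^{j−(m−a)}`)** — F0P3a-p01 (g32) E1 v0 §3 (b) in ★ T4 letters.
[cite: Serre1979, Ch. III §6 Prop. 12] [cite: Jacobowitz1962, §4] -/
theorem div_mem_order_iff_of_v_eq (hα : ρ α ≠ α) (hint : ∀ z : K, Valued.v z ≤ 1 → Valued.v ((z - ρ z) / (α - ρ α)) ≤ 1)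
    {ϖE : K} (hρϖ : ρ ϖE = ϖE) (hϖ0 : ϖE ≠ 0) (hϖ1 : Valued.v ϖE < 1) {y μ : K} (hy0 : y ≠ 0) {a m : ℕ}
    (hy : Valued.v y = Valued.v ϖE ^ a) (hμ : Valued.v μ = Valued.v ϖE ^ m) (j : ℕ) :
    (Valued.v (μ / y) ≤ 1 ∧ Valued.v (μ / y - ρ (μ / y)) ≤ Valued.v (ϖE ^ j * (α - ρ α))) ↔
      a ≤ m ∧ (j ≤ m - a ∨ (Valued.v (μ / (y * ϖE ^ (m - a))) ≤ 1 ∧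
        Valued.v (μ / (y * ϖE ^ (m - a)) - ρ (μ / (y * ϖE ^ (m - a)))) ≤ Valued.v (ϖE ^ (j - (m - a)) * (α - ρ α)))) := by
  have hvϖ0 : Valued.v ϖE ≠ 0 := (Valuation.ne_zero_iff _).2 hϖ0
  by_cases ham : a ≤ m
  · -- `μ∕y = ϖE^{m−a} · z` with `z := μ∕(y·ϖE^{m−a})` an integer (in fact a unit)
    have hz_eq : μ / y = ϖE ^ (m - a) * (μ / (y * ϖE ^ (m - a))) := by
      field_simp
    have hz1 : Valued.v (μ / (y * ϖE ^ (m - a))) ≤ 1 := by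
      rw [map_div₀, map_mul, map_pow, hμ, hy, ← pow_add, show a + (m - a) = m by omega,
        div_self (pow_ne_zero _ hvϖ0)]
    have hzδ := v_sub_map_le_of_v_le_one hα hint hz1
    rw [hz_eq, order_pow_mul_iff hρϖ hϖ0 hϖ1.le hz1 hzδ j (m - a)]
    simp only [ham, true_and]
  · -- `a > m`: `μ∕y` is not even integral (`|y| < |μ|`)
    have hlt : Valued.v y < Valued.v μ := by
      rw [hy, hμ]; exact pow_lt_pow_right_of_lt_one₀ (zero_lt_iff.2 hvϖ0) hϖ1 (by omega)
    have hvy0 : 0 < Valued.v y := zero_lt_iff.2 ((Valuation.ne_zero_iff _).2 hy0)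
    constructor
    · rintro ⟨h1, -⟩
      rw [map_div₀, div_le_one₀ hvy0] at h1
      exact absurd h1 (not_le.2 hlt)
    · rintro ⟨h, -⟩; exact absurd h ham

/-- **(D0) THE DEPTH CONDITION ON THE LATTICE `Λ = x₀·𝒪_j`, UNIT FORM** (the sentence `mem_levelSetDep_iff` of the T5 sheets; type-free).  With the hermitian dual of ★ T4c
(`Tr(h·Θ(x)·b)`, dual generator `y = h·(x₀Θx₀)·(ϖE^j(α − ρα))`, `h, x₀ ≠ 0`) and the tokens `|y| = |ϖE|^a`, `|μ| = |ϖE|^m`: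
`(∀ b ∈ Λ^#, μ·b ∈ Λ) ⟺ a ≤ m ∧ (j ≤ m − a ∨ μ∕(y·ϖE^{m−a}) ∈ 𝒪_{ϖE^{j−(m−a)}})`. [cite: Jacobowitz1962, §4] [cite: Serre1979, Ch. III §6 Prop. 12] -/
theorem forall_dual_mul_mem_iff_depthUnit (hρρ : ∀ x, ρ (ρ x) = x) (hvρ : ∀ x, Valued.v (ρ x) = Valued.v x) (hα : ρ α ≠ α) (hα1 : Valued.v α ≤ 1)
    (hint : ∀ z : K, Valued.v z ≤ 1 → Valued.v ((z - ρ z) / (α - ρ α)) ≤ 1)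
    (hΘΘ : ∀ x, Θ (Θ x) = x) (hΘρ : ∀ x, Θ (ρ x) = ρ (Θ x)) (hvΘ : ∀ x, Valued.v (Θ x) = Valued.v x)
    {ϖE : K} (hρϖ : ρ ϖE = ϖE) (hϖ0 : ϖE ≠ 0) (hϖ1 : Valued.v ϖE < 1) {h : K} (hh : h ≠ 0) {Λ : AddSubgroup K} {x₀ : K} (hx₀ : x₀ ≠ 0) (j : ℕ)
    (hΛ : ∀ x, x ∈ Λ ↔ ∃ z, (Valued.v z ≤ 1 ∧ Valued.v (z - ρ z) ≤ Valued.v (ϖE ^ j * (α - ρ α))) ∧ x = x₀ * z)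
    {μ : K} {a m : ℕ} (hy : Valued.v (h * (x₀ * Θ x₀) * (ϖE ^ j * (α - ρ α))) = Valued.v ϖE ^ a) (hμ : Valued.v μ = Valued.v ϖE ^ m) :
    (∀ b, (∀ x ∈ Λ, Valued.v (h * Θ x * b + ρ (h * Θ x * b)) ≤ 1) → μ * b ∈ Λ) ↔
      a ≤ m ∧ (j ≤ m - a ∨
        (Valued.v (μ / (h * (x₀ * Θ x₀) * (ϖE ^ j * (α - ρ α)) * ϖE ^ (m - a))) ≤ 1 ∧
          Valued.v (μ / (h * (x₀ * Θ x₀) * (ϖE ^ j * (α - ρ α)) * ϖE ^ (m - a)) -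
              ρ (μ / (h * (x₀ * Θ x₀) * (ϖE ^ j * (α - ρ α)) * ϖE ^ (m - a)))) ≤ Valued.v (ϖE ^ (j - (m - a)) * (α - ρ α)))) := by
  have hc : ρ (ϖE ^ j) = ϖE ^ j := by rw [map_pow, hρϖ]
  have hc0 : ϖE ^ j ≠ 0 := pow_ne_zero _ hϖ0
  have hc1 : Valued.v (ϖE ^ j) ≤ 1 := by rw [map_pow]; exact pow_le_one' hϖ1.le _
  have hy0 : h * (x₀ * Θ x₀) * (ϖE ^ j * (α - ρ α)) ≠ 0 :=
    mul_ne_zero (mul_ne_zero hh (mul_ne_zero hx₀ ((map_ne_zero Θ).2 hx₀))) (mul_ne_zero hc0 (sub_ne_zero.2 (Ne.symm hα)))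
  rw [forall_dual_mul_mem_iff hρρ hvρ hα hα1 hint hΘΘ hΘρ hvΘ hc hc0 hc1 hh hx₀ hΛ μ]
  exact div_mem_order_iff_of_v_eq hα hint hρϖ hϖ0 hϖ1 hy0 hy hμ j

end Literature.NumberTheory.LocalFields.QuadraticOrder
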